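import Mathlib
import Summits.Ventures.LatticeQCDFlow.TrivializingMaps.StrongCouplingTrivializingMap
import Summits.Ventures.LatticeQCDFlow.TrivializingMaps.GeneratorLocality
import HarnessLib

/-!
# The strong-coupling trivializing flow has an exponentially local generator, uniformly in the volume

HONEST FRAMING: exact (Metropolis-corrected) sampling algorithms for lattice gauge theory; figures
of merit are autocorrelation/cost numbers at stated couplings and volumes; no continuum-physics claim.
Finite periodic lattices `(ℤ/L)^d`; every constant below is independent of `L`.

M. Lüscher, CMP 293 (2010) 899–919 [Luscher2010Trivializing], §4.5(b): "At the values of `t`, where the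
expansion converges, the action `S̃_t` is then guaranteed to be local as well."  Theory-1's C2
(`GeneratorLocality.generatorSeries_exponentially_local`) proved this for the generator SERIES; the present
file states it for the generator `Z_t = -∂S̃_t` of THE trivializing flow of `StrongCouplingTrivializingMap.lean`
(the flow whose time-one map trivializes `β·S_W` for `|β| < β₀(d,n,B)`, every `L`):

* `linkDeriv_flowActionG_eq` — on `SU(n)^E`, at every time, `∂^a_e S̃^G_t(ιU)` is the gradient series
  `∑_k σ(t)^k β^{k+1} ∂^a_e S̃^{(k)}(ιU)` (`σ` the time clamp, `|σ| ≤ 2`);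
* `linkDeriv_flowActionG_local` — **for all `U, U' ∈ SU(n)^E` agreeing on the plaquette ball
  `linkBall (2(K+1)) e`: `|∂^a_e S̃^G_t(ιU) - ∂^a_e S̃^G_t(ιU')| ≤ 2 |β| N₀ q^{K+1}/(1-q)` with
  `q = 2|β|θ₁(d,n,B) < 1`** — the colour components of the generator of the trivializing flow at a link are
  determined by the links within plaquette distance `2(K+1)` up to an error decaying geometrically in `K`, with
  RATE AND CONSTANT INDEPENDENT OF THE LATTICE SIZE (and of `t`, `U`).

Authored by the pub-lqcd lean-2 seat (cell lqcd-flow, FANOUT row 31 GEN-4). Tags: [ours].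
-/

noncomputable section

namespace Summit.Ventures.LatticeQCDFlow.TrivializingMaps

open scoped Matrix Matrix.Norms.Frobenius ContDiff
open Literature.MathematicalPhysics.QuantumFieldTheory
open Literature.MathematicalPhysics.QuantumFieldTheory.Luscher2010
open GradedSeries AnalyticSeries

namespace StrongCoupling

variable {d L n : ℕ} [NeZero L]

omit [NeZero L] in
/-- Inside the window, `|s|·|β| < θ₁⁻¹` for every `|s| ≤ 2` (so the gradient series converges at every
clamped time). [ours] -/
theorem window_series_two (hn : n ≠ 0) {β s : ℝ} {B : SuBasis n} (hβ : |β| < beta0 d n B) (hs : |s| ≤ 2) :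
    |s| * |β| < (theta1 d n B)⁻¹ := by
  have hθ1 : 1 ≤ theta1 d n B := one_le_theta1 d n B
  have hθ : 0 < theta1 d n B := zero_lt_one.trans_le hθ1
  have hn1 : (1 : ℝ) ≤ (n : ℝ) := by exact_mod_cast Nat.one_le_iff_ne_zero.2 hn
  set X : ℝ := (n : ℝ) ^ 8 * theta1 d n B * 3 ^ 5 with hX
  have hX1 : 0 < X + 1 := by positivity
  have h2θX : 2 * theta1 d n B ≤ X := by
    rw [hX]
    have h8 : (1 : ℝ) ≤ (n : ℝ) ^ 8 := one_le_pow₀ hn1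
    nlinarith
  have hb : |β| * (X + 1) < 1 := by
    have := mul_lt_mul_of_pos_right hβ hX1
    rwa [beta0, ← hX, inv_mul_cancel₀ hX1.ne'] at this
  have hkey : |s| * |β| * theta1 d n B < 1 := by
    calc |s| * |β| * theta1 d n B ≤ 2 * |β| * theta1 d n B := by gcongr
      _ = |β| * (2 * theta1 d n B) := by ring
      _ ≤ |β| * X := by nlinarith [abs_nonneg β]
      _ ≤ |β| * (X + 1) := by nlinarith [abs_nonneg β]
      _ < 1 := hb
  rw [inv_eq_one_div, lt_div_iff₀ hθ]
  exact hkey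

omit [NeZero L] in
/-- Inside the window the locality rate `q = 2|β|θ₁` is `< 1`. [ours] -/
theorem two_mul_abs_mul_theta1_lt_one (hn : n ≠ 0) {β : ℝ} {B : SuBasis n} (hβ : |β| < beta0 d n B) :
    2 * |β| * theta1 d n B < 1 := by
  have hθ : 0 < theta1 d n B := zero_lt_one.trans_le (one_le_theta1 d n B)
  have h := window_series_two (d := d) hn hβ (s := 2) (by norm_num)
  rw [inv_eq_one_div, lt_div_iff₀ hθ] at h
  have h2 : |(2 : ℝ)| = 2 := abs_of_pos two_pos
  rw [h2] at h
  linarith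

/-- **The gradient of the trivializing flow action is the gradient series**, at every time and every point
of `SU(n)^E`: `∂^a_e S̃^G_t(ιU) = ∑_k σ(t)^k β^{k+1} ∂^a_e S̃^{(k)}(ιU)`. [ours] -/
theorem linkDeriv_flowActionG_eq (hn : n ≠ 0) (B : SuBasis n) {β : ℝ} (hβ : |β| < beta0 d n B) (t : ℝ)
    (U : GaugeConfig d L (Matrix.specialUnitaryGroup (Fin n) ℂ)) (e : Edge d L) (a : B.ι) :
    linkDeriv e (B.T a) (flowActionG (d := d) (L := L) B β t) (WilsonFlow.coeConfig U) =
      ∑' k, clamp t ^ k * (β ^ (k + 1) *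
        linkDeriv e (B.T a) (gradedSk (d := d) (L := L) B k) (WilsonFlow.coeConfig U)) := by
  rw [linkDeriv_coeConfig_congr (φ := flowActionG (d := d) (L := L) B β t)
    (ψ := fun W => ∑' k, clamp t ^ k * (β ^ (k + 1) * gradedSk (d := d) (L := L) B k W))
    (fun V => flowActionG_coeConfig B β t V) e (B.mem a) U,
    linkDeriv_wilsonSeries_eq B hn (window_series_two hn hβ (abs_clamp_le t)) U e a]
  exact tsum_congr fun k => by rw [linkDeriv_const_mul']

/-- **The generator of the strong-coupling trivializing flow is exponentially local, uniformly in the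
volume (ours; PROVED).**  For every `d`, `n ≠ 0`, basis `B`, coupling `|β| < β₀(d,n,B)`, time `t`, order
`K`, link `e`, colour `a`, and all `U, U' ∈ SU(n)^E` that agree on the plaquette ball `linkBall (2(K+1)) e`:
`|∂^a_e S̃^G_t(ιU) - ∂^a_e S̃^G_t(ιU')| ≤ 2 (|β| N₀) q^{K+1} / (1 - q)`, `q = 2|β|θ₁ < 1` — the truncations
at order `K` coincide (footprint `2(k+1)`, `linkDeriv_series_local`) and each tail is geometric.  Rate and
constant do not depend on `L`, `t` or `U`. [ours; cite: Luscher2010Trivializing, §4.5(b)] -/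
theorem linkDeriv_flowActionG_local (hn : n ≠ 0) (B : SuBasis n) {β : ℝ} (hβ : |β| < beta0 d n B) (t : ℝ)
    (K : ℕ) (e : Edge d L) (a : B.ι) {U U' : GaugeConfig d L (Matrix.specialUnitaryGroup (Fin n) ℂ)}
    (hUU' : ∀ e' ∈ linkBall (2 * (K + 1)) e, U e' = U' e') :
    |linkDeriv e (B.T a) (flowActionG (d := d) (L := L) B β t) (WilsonFlow.coeConfig U) -
        linkDeriv e (B.T a) (flowActionG (d := d) (L := L) B β t) (WilsonFlow.coeConfig U')| ≤
      2 * ((|β| * N0 d n) * (2 * |β| * theta1 d n B) ^ (K + 1) / (1 - 2 * |β| * theta1 d n B)) := by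
  set q : ℝ := 2 * |β| * theta1 d n B with hq
  have hθ : 0 ≤ theta1 d n B := zero_le_one.trans (one_le_theta1 d n B)
  have hq0 : 0 ≤ q := by positivity
  have hq1 : q < 1 := two_mul_abs_mul_theta1_lt_one (d := d) hn hβ
  -- the terms and their geometric majorant at both points
  set f : GaugeConfig d L (Matrix.specialUnitaryGroup (Fin n) ℂ) → ℕ → ℝ := fun V k =>
    clamp t ^ k * (β ^ (k + 1) * linkDeriv e (B.T a) (gradedSk (d := d) (L := L) B k) (WilsonFlow.coeConfig V))
    with hf
  have hterm : ∀ (V : GaugeConfig d L (Matrix.specialUnitaryGroup (Fin n) ℂ)) (k : ℕ),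
      |f V k| ≤ |β| * N0 d n * q ^ k := by
    intro V k
    rw [hf]
    simp only
    rw [abs_mul, abs_mul, abs_pow, abs_pow]
    have h1 : |clamp t| ^ k ≤ (2 : ℝ) ^ k := pow_le_pow_left₀ (abs_nonneg _) (abs_clamp_le t) k
    have h2 := abs_linkDeriv_gradedSk_le B hn k V e a
    calc |clamp t| ^ k * (|β| ^ (k + 1) * |linkDeriv e (B.T a) (gradedSk (d := d) (L := L) B k)
          (WilsonFlow.coeConfig V)|) ≤ (2 : ℝ) ^ k * (|β| ^ (k + 1) * (N0 d n * theta1 d n B ^ k)) :=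
          mul_le_mul h1 (mul_le_mul_of_nonneg_left h2 (pow_nonneg (abs_nonneg β) _)) (by positivity)
            (by positivity)
      _ = |β| * N0 d n * q ^ k := by rw [hq, mul_pow, mul_pow, pow_succ]; ring
  -- truncations agree
  have htrunc : ∑ k ∈ Finset.range (K + 1), f U k = ∑ k ∈ Finset.range (K + 1), f U' k := by
    refine Finset.sum_congr rfl fun k hk => ?_
    rw [hf]
    simp only
    have hk' : 2 * (k + 1) ≤ 2 * (K + 1) := by have := Finset.mem_range.1 hk; omega
    have hloc := linkDeriv_series_local B β (contDiff_smul_gradedSk (d := d) (L := L) B β)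
      (isLuscherSeries_smul_gradedSk B β) k e a (U := U) (U' := U')
      fun e' he' => hUU' e' (linkBall_mono hk' e he')
    rw [linkDeriv_const_mul', linkDeriv_const_mul'] at hloc
    rw [hloc]
  -- tails
  have hU := abs_tsum_sub_sum_le_of_geometric hq0 hq1 (hterm U) K
  have hU' := abs_tsum_sub_sum_le_of_geometric hq0 hq1 (hterm U') K
  rw [linkDeriv_flowActionG_eq hn B hβ t U e a, linkDeriv_flowActionG_eq hn B hβ t U' e a]
  change |∑' k, f U k - ∑' k, f U' k| ≤ _
  rw [htrunc] at hU
  exact abs_sub_le_two_mul_of_near hU.2 hU'.2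

end StrongCoupling

end Summit.Ventures.LatticeQCDFlow.TrivializingMaps

end
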